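/-
Copyright (c) 2026 the pub-hodgecm-mathlib formalisation cell (harness21).  Prover seat hodgecm-mathlib-K2E4-p11 (g3), Track B ∕ K2-LIT, h413 =
`stmt-HodgeConjecture-24833`, campaign «EIS-RANK-ONE» rung R6f(i), the U(1)-FIBRE; DEAL BY NAME (β) of the dealer K2E1-plan (g3) 2026-09-04T05:11:10Z.
-/
import Summits.HodgeConjecture.HodgeConjecture.Theorems.K2E1EisensteinPairingUnfolded     -- ★ p857542 (this seat): `δ_B t = ‖d₀ t‖²`, the `d₀`-push
import Literature.MeasureTheory.Group.CoveringWeightsBochner                          -- ★ Bochner weight independence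
import Mathlib.Topology.Maps.OpenQuotient
import HarnessLib

/-!
# K2·E1 — `K2E1EisensteinPairingTorusFibreU3` (rung R6f(i), the `U(1)`-fibre of `d₀ : T(𝔸) ↠ 𝕀_E`): A TORUS BRACKET WITH A CHARACTER NON-TRIVIAL ON
# `ker d₀ ≅ U(1)(𝔸_F)` VANISHES, AND A CHARACTER TRIVIAL THERE FACTORS THROUGH `d₀`

Track B ∕ K2-LIT, crux h413 = `stmt-HodgeConjecture-24833`, route of record `HCCMUnconditional`; cell `hodgecm-mathlib`, squad K2, ENGINE E1, campaign EIS-RANK-ONE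
(SPEC `K2/K2E1-plan/g3/SPEC-EIS-R6-MaassSelberg.K2E1-plan-g3.md` §2 R6f).  Prover seat `hodgecm-mathlib-K2E4-p11` (g3); DEAL BY NAME (β) of the dealer K2E1-plan (g3)
2026-09-04T05:11:10Z — the «NOT COVERED» item of ★ p857542 `K2E1EisensteinPairingUnfolded` §3 and of ★ p857517 `K2E1TorusHeightMellin`.  THEOREMS ONLY (no `def`,
no `instance`, no notation, no named-fact hypothesis, no `sorry`); lane `--kind proof --supports stmt-HodgeConjecture-24833 --as helper` (count-neutral, closes no socket).

SETTING.  `G = U(J₃)` quasi-split over a quadratic `E/F`; `T(𝔸) = torusInBorel F E c 3 ∋ t = diag(d₀, d₁, (c d₀)⁻¹)`, `d₁ ∈ U(1)(𝔸_F)`; the first-entry homomorphism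
`d₀ : T(𝔸) ↠ 𝕀_E` (★ `UnitaryGroupTorusIdeleUnfolding`: continuous, open, surjective for `c² = 1`, `d₀(Γ_T) = E^×`) with fibre `ker d₀ = {diag(1, b, 1)} ≅ U(1)(𝔸_F)`;
the rational torus `Γ_T = (rationalBorel F E c 3).subgroupOf (torusInBorel F E c 3)`, covering weights `w_T` (Σ_{τ ∈ Γ_T} w_T(τ t) = 1), so that
`∫ (w_T t) • G(t) dμ_T` is «`∫_{T(F)∖T(𝔸)} G`» for `Γ_T`-invariant `G` (independent of `w_T`, ★ `integral_wt_smul_eq_of_coveringSum_eq_one`).  After ★ p857542 §1 the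
Maass–Selberg pairing is such a torus bracket of `t ↦ δ_B(t)⁻¹ ∫_{K_U} Ψ(t k)`, a finite sum of terms `η(t) · Φ(d₀ t)` with `η` a character of `T(F)∖T(𝔸)`
(from `χ · conj χ'` of the two inducing characters) and `Φ` an `E^×`-invariant function of `d₀ t` (powers of `H = ‖d₀‖` and cut-offs).  THE DICHOTOMY:
* §1–§2 **`η` NON-TRIVIAL ON `ker d₀` ⟹ the bracket VANISHES**: `∫ (w_T t) • (η t · Φ(d₀ t)) dμ_T = 0` (`integral_weight_smul_character_mul_comp_diagUnitZero_eq_zero`) — no Fubini,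
  no compactness: pick `s ∈ ker d₀` with `η s ≠ 1`; the bracket of the `Γ_T`-invariant `G = η · (Φ ∘ d₀)` is invariant under `t ↦ s t` (left-invariance of `μ_T` moves `s`
  onto the weight, ★ `isCoveringWeight_comp_mul_left` + ★ weight independence move it back) while `G(s t) = η(s) G(t)`, so `(1 − η s) · I = 0`
  (`integral_weight_smul_eq_zero_of_eigen_translate`, §1).  This is the torus-side companion of ★ p857517 `bracket_character_eq_zero` (which kills, AFTER the
  `d₀`-push, the characters of `E^×∖𝕀_E` non-trivial on the rays).
* §3 **`η` TRIVIAL ON `ker d₀` ⟹ `η = η♭ ∘ d₀`** for a continuous character `η♭` of `𝕀_E`, trivial on `E^×` when `η` is trivial on `Γ_T`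
  (`exists_character_comp_diagUnitZero`: a section of ★ `diagUnitZeroHom_surjective`, continuity through the open quotient map `d₀`, ★
  `map_rationalTorusInBorel_diagUnitZero_eq_principalIdeles`) — then ★ p857542 §3 applies with `Φ · η♭`, and the Mellin side (★ p857492∕p857517) evaluates.
Together: «the cross terms `[f_χ, f'_{χ'}]` of Maass–Selberg vanish unless `χ' = χ` on all of `T(F)∖T(𝔸)`», which the per-character count (H4-b) reads.
[Rogawski1990, §7.3 (p. 97): the torus `M` modulo `S′ = ker α₁`, «`m(ZS′∖S′)`»; MoeglinWaldspurger1995, II.1.7 and IV.2 (cuspidal∕character components are orthogonal);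
Garrett2018, §1.11 (the four terms, `⟨χ, χ'⟩ = 0` unless `χ' = χ`); Folland1995, §2.6 Thm. 2.49.]

HONEST LABEL: HC_CM is proved only modulo the 7 printed citations (2 remaining named inputs: hLiu418 = `stmt-HodgeConjecture-24832`, h413 = `stmt-HodgeConjecture-24833`) until
rung 0 closes; count-neutral helper, closes no socket.

## References
* [Rogawski1990] J. D. Rogawski, *Automorphic Representations of Unitary Groups in Three Variables*, Ann. of Math. Stud. 123 (1990), §7.3 (p. 97), §1.10.
* [MoeglinWaldspurger1995] C. Mœglin, J.-L. Waldspurger, *Spectral Decomposition and Eisenstein Series* (1995), II.1.7, IV.2.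
* [Garrett2018] P. Garrett, *Modern Analysis of Automorphic Forms by Example* (2018), §1.10–1.11.
* [Folland1995] G. B. Folland, *A Course in Abstract Harmonic Analysis* (1995), §2.6 Thm. 2.49.
-/

set_option autoImplicit false
-- the mandated namespace repeats the single-problem summit's segment (`HodgeConjecture.HodgeConjecture`)
set_option linter.dupNamespace false

noncomputable section

open MeasureTheory MeasureTheory.Measure Set NumberField IsDedekindDomain
open scoped ENNReal NNReal
open Literature.MeasureTheory.Group Literature.NumberTheory
open Literature.NumberTheory.Automorphic Literature.NumberTheory.Automorphic.UnitaryGroup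

namespace Summit.HodgeConjecture.HodgeConjecture.Cruxes.H413.K2E1EisensteinPairingTorusFibreU3

variable {F E : Type} [Field F] [NumberField F] [Field E] [NumberField E] [Algebra F E] {c : E ≃ₐ[F] E}

/-! ## §1 The mechanism: an eigen-translation kills a torus bracket -/

section Bracket

variable [MeasurableSpace (quasiSplit F E c 3).Adelic] [BorelSpace (quasiSplit F E c 3).Adelic]

/-- **AN EIGEN-TRANSLATION KILLS THE BRACKET.**  On the adelic torus `T(𝔸) ≤ B(𝔸) ≤ U(J₃)(𝔸)` with a left-invariant measure `μ_T`, let `w_T` be a covering weight of the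
rational torus `Γ_T` and `G : T(𝔸) → ℂ` Borel, `Γ_T`-invariant, with `∫⁻ ‖G‖ w_T dμ_T < ∞`.  If some `s ∈ T(𝔸)` acts on `G` by a scalar `a ≠ 1` — `G(s t) = a · G(t)` for all `t` —
then `∫ (w_T t) • G(t) dμ_T = 0`: the bracket is unchanged by `t ↦ s t` (Mathlib `integral_mul_left_eq_self` moves `s` onto the weight; the translate `w_T(s⁻¹ ·)` is again a
covering weight, ★ `isCoveringWeight_comp_mul_left`, and ★ `integral_wt_smul_eq_of_coveringSum_eq_one` moves it back), and multiplied by `a`.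
[cite: Folland1995, §2.6 Thm. 2.49] [cite: Rogawski1990, §7.3 (p. 97)] -/
theorem integral_weight_smul_eq_zero_of_eigen_translate (μT : Measure (torusInBorel F E c 3)) [μT.IsMulLeftInvariant]
    {wT : torusInBorel F E c 3 → ℝ≥0∞}
    (hwT : IsCoveringWeight ((rationalBorel F E c 3).subgroupOf (torusInBorel F E c 3)) wT)
    {G : torusInBorel F E c 3 → ℂ} (hGm : Measurable G)
    (hGΓ : ∀ (τ : (rationalBorel F E c 3).subgroupOf (torusInBorel F E c 3)) (t : torusInBorel F E c 3), G (τ • t) = G t)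
    (hfin : ∫⁻ t, ‖G t‖ₑ * wT t ∂μT < ∞)
    {s : torusInBorel F E c 3} {a : ℂ} (ha : a ≠ 1) (hGs : ∀ t, G (s * t) = a * G t) :
    ∫ t, (wT t).toReal • G t ∂μT = 0 := by
  haveI := countable_rationalTorusInBorel (F := F) (E := E) (c := c) (N := 3)
  haveI := measurableConstSMul_rationalTorusInBorel (F := F) (E := E) (c := c) (N := 3)
  haveI := smulInvariantMeasure_rationalTorusInBorel (F := F) (E := E) (c := c) (N := 3) μT
  -- the translated weight
  have hwT' := isCoveringWeight_comp_mul_left hwT s⁻¹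
  -- the bracket is translation invariant …
  have h1 : ∫ t, (wT t).toReal • G (s * t) ∂μT = ∫ t, (wT t).toReal • G t ∂μT := by
    have h := integral_mul_left_eq_self (μ := μT) (fun t : torusInBorel F E c 3 => (wT (s⁻¹ * t)).toReal • G t) s
    simp only [inv_mul_cancel_left] at h
    rw [h]
    exact (integral_wt_smul_eq_of_coveringSum_eq_one μT hGm.stronglyMeasurable hGΓ hwT'.measurable hwT.measurable
      hwT'.coveringSum_eq hwT.coveringSum_eq (by
        rw [lintegral_enorm_mul_eq_of_coveringSum_eq_one μT hGm.stronglyMeasurable hGΓ hwT'.measurable hwT.measurable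
          hwT'.coveringSum_eq hwT.coveringSum_eq]
        exact hfin))
  -- … and multiplied by `a`
  have h2 : ∫ t, (wT t).toReal • G (s * t) ∂μT = a * ∫ t, (wT t).toReal • G t ∂μT := by
    rw [← integral_const_mul]
    refine integral_congr_ae (ae_of_all _ fun t => ?_)
    simp only [hGs t, Complex.real_smul]
    ring
  have h3 : (a - 1) * ∫ t, (wT t).toReal • G t ∂μT = 0 := by rw [sub_mul, one_mul, ← h2, h1, sub_self]
  rcases mul_eq_zero.1 h3 with h | h
  · exact absurd (sub_eq_zero.1 h) ha
  · exact h

/-! ## §2 The `U(1)`-fibre: a character non-trivial on `ker d₀` kills the bracket of `η · (Φ ∘ d₀)` -/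

/-- **THE TORUS BRACKET OF `η ⊗ (Φ ∘ d₀)` VANISHES WHEN `η|_{ker d₀} ≠ 1`.**  `μ_T` left-invariant on `T(𝔸)`, `w_T` a covering weight of `Γ_T`; `η : T(𝔸) →* ℂ` a Borel character
with `‖η‖ ≤ 1`, trivial on the rational torus `Γ_T` and NOT trivial on the fibre: `η s ≠ 1` for some `s` with `d₀ s = 1`; `Φ : 𝕀_E → ℂ` Borel, `E^×`-invariant, with
`∫⁻ ‖Φ(d₀ t)‖ w_T dμ_T < ∞`.  Then
  `∫ (w_T t) • (η(t) · Φ(d₀ t)) dμ_T(t) = 0`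
— §1 with `G = η · (Φ ∘ d₀)` (`Γ_T`-invariant: `η(τ) = 1`, `d₀ τ ∈ E^×` ★ `diagUnit_zero_mem_principalIdeles_of_mem`; `G(s t) = η(s) G(t)` as `d₀(s t) = d₀ t`).  The companion, on the
torus side of the `d₀`-push, of ★ p857517 `bracket_character_eq_zero`. [cite: Rogawski1990, §7.3 (p. 97)] [cite: MoeglinWaldspurger1995, IV.2] [cite: Garrett2018, §1.11] -/
theorem integral_weight_smul_character_mul_comp_diagUnitZero_eq_zero (μT : Measure (torusInBorel F E c 3)) [μT.IsMulLeftInvariant]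
    {wT : torusInBorel F E c 3 → ℝ≥0∞}
    (hwT : IsCoveringWeight ((rationalBorel F E c 3).subgroupOf (torusInBorel F E c 3)) wT)
    (η : torusInBorel F E c 3 →* ℂ) (hηm : Measurable η) (hη1 : ∀ t, ‖η t‖ ≤ 1)
    (hηΓ : ∀ τ : (rationalBorel F E c 3).subgroupOf (torusInBorel F E c 3), η (τ : torusInBorel F E c 3) = 1)
    {s : torusInBorel F E c 3} (hs : diagUnit (s : borelAdelic F E c 3).2 0 = 1) (hηs : η s ≠ 1)
    [MeasurableSpace (AdeleRing (𝓞 E) E)ˣ] [BorelSpace (AdeleRing (𝓞 E) E)ˣ]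
    (Φ : (AdeleRing (𝓞 E) E)ˣ → ℂ) (hΦm : Measurable Φ)
    (hΦinv : ∀ k ∈ GaloisRepresentations.principalIdeles E, ∀ x, Φ (k * x) = Φ x)
    (hfin : ∫⁻ t, ‖Φ (diagUnit (t : borelAdelic F E c 3).2 0)‖ₑ * wT t ∂μT < ∞) :
    ∫ t, (wT t).toReal • (η t * Φ (diagUnit (t : borelAdelic F E c 3).2 0)) ∂μT = 0 := by
  have hd₀ : Measurable fun t : torusInBorel F E c 3 => diagUnit (t : borelAdelic F E c 3).2 0 :=
    (continuous_diagUnit_torus (F := F) (E := E) (c := c) 0).measurable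
  refine integral_weight_smul_eq_zero_of_eigen_translate (s := s) μT hwT (hηm.mul (hΦm.comp hd₀)) ?_ ?_ hηs ?_
  · -- `Γ_T`-invariance
    intro τ t
    rw [Subgroup.smul_def, smul_eq_mul, map_mul, hηΓ τ, one_mul, diagUnit_torus_mul,
      hΦinv _ (diagUnit_zero_mem_principalIdeles_of_mem τ)]
  · -- finiteness: `‖η Φ‖ ≤ ‖Φ‖`
    have hη1' : ∀ t, ‖η t‖ₑ ≤ 1 := fun t => by
      rw [← ofReal_norm]; exact ENNReal.ofReal_le_one.2 (hη1 t)
    refine lt_of_le_of_lt (lintegral_mono fun t => ?_) hfin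
    rw [enorm_mul]
    calc ‖η t‖ₑ * ‖Φ (diagUnit (t : borelAdelic F E c 3).2 0)‖ₑ * wT t
        ≤ 1 * ‖Φ (diagUnit (t : borelAdelic F E c 3).2 0)‖ₑ * wT t := by gcongr; exact hη1' t
      _ = ‖Φ (diagUnit (t : borelAdelic F E c 3).2 0)‖ₑ * wT t := by rw [one_mul]
  · -- the eigen-translation by `s ∈ ker d₀`
    intro t
    rw [map_mul, diagUnit_torus_mul, hs, one_mul, mul_assoc]

/-- **THE SAME IN THE SHAPE OF ★ p857542 §1** (the torus integrand `(w_T(t) δ_B(t)⁻¹) • (η t · Φ(d₀ t))` of the unfolded pairing): it vanishes too — `δ_B(t)⁻¹ = ‖d₀ t‖⁻²` is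
absorbed into `Φ` (★ `torusRootModulus_diagUnit_torus_eq_ideleNorm_mul`). Finiteness is asked for the absorbed `Φ`. [cite: Rogawski1990, §7.3 (p. 97)] [cite: Garrett2018, §1.11] -/
theorem integral_weight_mul_torusRootModulus_inv_smul_character_mul_comp_diagUnitZero_eq_zero
    (μT : Measure (torusInBorel F E c 3)) [μT.IsMulLeftInvariant]
    {wT : torusInBorel F E c 3 → ℝ≥0∞}
    (hwT : IsCoveringWeight ((rationalBorel F E c 3).subgroupOf (torusInBorel F E c 3)) wT)
    (η : torusInBorel F E c 3 →* ℂ) (hηm : Measurable η) (hη1 : ∀ t, ‖η t‖ ≤ 1)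
    (hηΓ : ∀ τ : (rationalBorel F E c 3).subgroupOf (torusInBorel F E c 3), η (τ : torusInBorel F E c 3) = 1)
    {s : torusInBorel F E c 3} (hs : diagUnit (s : borelAdelic F E c 3).2 0 = 1) (hηs : η s ≠ 1)
    [MeasurableSpace (AdeleRing (𝓞 E) E)ˣ] [BorelSpace (AdeleRing (𝓞 E) E)ˣ]
    (Φ : (AdeleRing (𝓞 E) E)ˣ → ℂ) (hΦm : Measurable Φ)
    (hΦinv : ∀ k ∈ GaloisRepresentations.principalIdeles E, ∀ x, Φ (k * x) = Φ x)
    (hfin : ∫⁻ t, ‖((IdeleClassGroup.ideleNorm E (diagUnit (t : borelAdelic F E c 3).2 0) : ℝ) *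
        (IdeleClassGroup.ideleNorm E (diagUnit (t : borelAdelic F E c 3).2 0) : ℝ))⁻¹ •
        Φ (diagUnit (t : borelAdelic F E c 3).2 0)‖ₑ * wT t ∂μT < ∞) :
    ∫ t, ((wT t).toReal * ((torusRootModulus E 3 (diagUnit (t : borelAdelic F E c 3).2) : ℝ≥0) : ℝ)⁻¹) •
        (η t * Φ (diagUnit (t : borelAdelic F E c 3).2 0)) ∂μT = 0 := by
  have hnm : Measurable fun x : (AdeleRing (𝓞 E) E)ˣ => IdeleClassGroup.ideleNorm E x := (continuous_ideleNorm_holds E).measurable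
  have h := integral_weight_smul_character_mul_comp_diagUnitZero_eq_zero μT hwT η hηm hη1 hηΓ hs hηs
    (fun x => ((IdeleClassGroup.ideleNorm E x : ℝ) * (IdeleClassGroup.ideleNorm E x : ℝ))⁻¹ • Φ x)
    ((((measurable_coe_nnreal_real.comp hnm).mul (measurable_coe_nnreal_real.comp hnm)).inv).smul hΦm)
    (fun k hk x => by simp only [map_mul, ideleNorm_principal hk, one_mul, hΦinv k hk x]) hfin
  rw [← h]
  refine integral_congr_ae (ae_of_all _ fun t => ?_)
  have hδ : ((torusRootModulus E 3 (diagUnit (t : borelAdelic F E c 3).2) : ℝ≥0) : ℝ) =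
      (IdeleClassGroup.ideleNorm E (diagUnit (t : borelAdelic F E c 3).2 0) : ℝ) *
        (IdeleClassGroup.ideleNorm E (diagUnit (t : borelAdelic F E c 3).2 0) : ℝ) := by
    rw [K2E1EisensteinPairingUnfolded.torusRootModulus_diagUnit_torus_eq_ideleNorm_mul, NNReal.coe_mul]
  simp only [hδ, Complex.real_smul, Complex.ofReal_mul, Complex.ofReal_inv]
  ring

end Bracket

/-! ## §3 The other branch: a character trivial on `ker d₀` factors through `d₀` -/

/-- **A CHARACTER OF `T(𝔸)` TRIVIAL ON THE FIBRE `ker d₀` FACTORS THROUGH `d₀`.**  For `c² = 1` and a continuous character `η : T(𝔸) →* ℂ` with `η s = 1` whenever `d₀ s = 1`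
there is a continuous character `η♭ : 𝕀_E →* ℂ` with `η = η♭ ∘ d₀` (`η♭ = η ∘ σ` for a set-theoretic section `σ` of the surjection ★ `diagUnitZeroHom_surjective`, a homomorphism because `η` is constant on the fibres; continuous because
`d₀` is an open quotient map, ★ `continuous_diagUnitZeroHom` + ★ `isOpenMap_diagUnitZeroHom`); if moreover `η` is trivial on the rational torus `Γ_T` then `η♭` is trivial on
`E^×` (★ `map_rationalTorusInBorel_diagUnitZero_eq_principalIdeles`: `d₀(Γ_T) = E^×`).  With §2 this is the dichotomy «killed on the torus ∕ pushed to `E^×∖𝕀_E`» for the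
characters entering the Maass–Selberg brackets (★ p857542 §3 then applies with `Φ · η♭`). [cite: Rogawski1990, §7.3 (p. 97)] [cite: MoeglinWaldspurger1995, IV.2] -/
theorem exists_character_comp_diagUnitZero (hc : c * c = 1) (η : torusInBorel F E c 3 →* ℂ) (hηc : Continuous η)
    (hker : ∀ s : torusInBorel F E c 3, diagUnit (s : borelAdelic F E c 3).2 0 = 1 → η s = 1) :
    ∃ ηf : (AdeleRing (𝓞 E) E)ˣ →* ℂ, Continuous ηf ∧
      (∀ t : torusInBorel F E c 3, η t = ηf (diagUnit (t : borelAdelic F E c 3).2 0)) ∧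
      ((∀ τ : (rationalBorel F E c 3).subgroupOf (torusInBorel F E c 3), η (τ : torusInBorel F E c 3) = 1) →
        ∀ k ∈ GaloisRepresentations.principalIdeles E, ηf k = 1) := by
  -- the surjection `d₀` and a set-theoretic section `si`
  have hsurj : Function.Surjective (MonoidHom.mk' (fun t : torusInBorel F E c 3 => diagUnit (t : borelAdelic F E c 3).2 0)
      (fun t t' => diagUnit_torus_mul t t' 0)) := diagUnitZeroHom_surjective hc
  set si : (AdeleRing (𝓞 E) E)ˣ → torusInBorel F E c 3 := Function.surjInv hsurj with hsi
  have hsi' : ∀ x : (AdeleRing (𝓞 E) E)ˣ, diagUnit ((si x : torusInBorel F E c 3) : borelAdelic F E c 3).2 0 = x := fun x => by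
    rw [← diagUnitZeroHom_apply (si x)]
    exact Function.rightInverse_surjInv hsurj x
  -- `η` is constant along the fibres of `d₀`
  have hfib : ∀ t t' : torusInBorel F E c 3,
      diagUnit (t : borelAdelic F E c 3).2 0 = diagUnit (t' : borelAdelic F E c 3).2 0 → η t = η t' := by
    intro t t' h
    have h1 : diagUnit (((t * t'⁻¹ : torusInBorel F E c 3)) : borelAdelic F E c 3).2 0 = 1 := by
      rw [← diagUnitZeroHom_apply, map_mul, map_inv, diagUnitZeroHom_apply, diagUnitZeroHom_apply, h, mul_inv_cancel]
    have h2 := hker _ h1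
    calc η t = η ((t * t'⁻¹) * t') := by rw [inv_mul_cancel_right]
      _ = η (t * t'⁻¹) * η t' := map_mul η _ _
      _ = η t' := by rw [h2, one_mul]
  have key : ∀ t : torusInBorel F E c 3, η (si (diagUnit (t : borelAdelic F E c 3).2 0)) = η t :=
    fun t => hfib _ _ (hsi' _)
  -- the lifted character, by hand
  refine ⟨{ toFun := fun x => η (si x)
            map_one' := ?_
            map_mul' := ?_ }, ?_, ?_, ?_⟩
  · -- `η (si 1) = η 1 = 1`
    have h := hfib (si 1) 1 (by rw [hsi', ← diagUnitZeroHom_apply, map_one])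
    rw [h, map_one]
  · intro x y
    have h := hfib (si (x * y)) (si x * si y) (by
      rw [hsi', ← diagUnitZeroHom_apply, map_mul, diagUnitZeroHom_apply, diagUnitZeroHom_apply, hsi', hsi'])
    rw [h, map_mul]
  · -- continuity through the open quotient map `d₀`
    have hq : IsOpenQuotientMap (fun t : torusInBorel F E c 3 => diagUnit (t : borelAdelic F E c 3).2 0) :=
      ⟨hsurj, continuous_diagUnit_torus (F := F) (E := E) (c := c) 0, isOpenMap_diagUnitZeroHom hc⟩
    rw [← hq.continuous_comp_iff]
    have hcomp : ((fun x : (AdeleRing (𝓞 E) E)ˣ => η (si x)) ∘ fun t : torusInBorel F E c 3 => diagUnit (t : borelAdelic F E c 3).2 0) = η :=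
      funext fun t => key t
    change Continuous ((fun x : (AdeleRing (𝓞 E) E)ˣ => η (si x)) ∘ fun t : torusInBorel F E c 3 => diagUnit (t : borelAdelic F E c 3).2 0)
    rw [hcomp]
    exact hηc
  · intro t
    exact (key t).symm
  · -- triviality on `E^× = d₀(Γ_T)`
    intro hηΓ k hk
    rw [← map_rationalTorusInBorel_diagUnitZero_eq_principalIdeles (F := F) (E := E) (c := c) hc] at hk
    obtain ⟨τ, hτ, rfl⟩ := hk
    change η (si _) = 1
    rw [diagUnitZeroHom_apply, key τ]
    exact hηΓ ⟨τ, hτ⟩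

end Summit.HodgeConjecture.HodgeConjecture.Cruxes.H413.K2E1EisensteinPairingTorusFibreU3

end
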